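import Summits.HodgeConjecture.HodgeConjecture.Theorems.MarkmanPartnerTransportPartnerOfMinusTwoClass
import Summits.HodgeConjecture.HodgeConjecture.Theorems.MarkmanPartnerTransportPartnerTransport
import Summits.HodgeConjecture.HodgeConjecture.Theorems.EndoscopicMiddleDegreeCupProductAlgebraic
import Summits.HodgeConjecture.HodgeConjecture.Theorems.MarkmanPartnerTransportPartnerPicardRank
import Summits.HodgeConjecture.HodgeConjecture.Theorems.NikulinTwinTransportSquareGlueFree
import Literature.AlgebraicGeometry.Surfaces.K3ComplexMultiplication

/-!
# Route MarkmanPartnerTransport · crux `LowPicardRealMultiplication` (#5, stmt-HodgeConjecture-19653) —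
# the rung «PARTNERED `ρ = 3`» (planner P1 g36, Sketch_OrphanRung_g36 `PicardThreePartneredK3Sq2Hodge`),
# modulo HC⁴ of K3 squares at Picard number EXACTLY `2`

The rung says: HC⁴(X) for every marked smooth projective `K3^{[2]}`-type `(X, φ, P, z)` with `ρ(X) = 3` whose
rational Néron–Severi space REPRESENTS `−2` (`∃ v ∈ ℚ²³`, `φ⁻¹(v ⊗ 1) ∈ N¹(X)`, `q(v) = −2` — the sketch's
`RepresentsMinusTwo X φ`, unfolded here; the planner's `def`s are not declared in this proof file). It follows from
X3a (`exists_k3Partner_of_minusTwoClass`: a projective K3 partner `S` exists; item #2 `partnerTransport_explicit`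
moves HC⁴(S ⊗ S) to HC⁴(X)) as soon as HC⁴ holds for the squares of marked projective K3 surfaces of Picard number
EXACTLY `2`: the partner has `ρ(X) ≤ ρ(S) + 1` (X3a) and `ρ(S) + 1 ≤ ρ(X)` from the surjectivity clause (g6)
(`finrank_algebraicClasses_succ_le_of_partner`, `…PartnerPicardRankLower`; equality form
`finrank_algebraicClasses_partner_eq_two_of_eq_three`, 20241-p1 g12's `…PartnerPicardRank`), so `ρ(S) = 2`. No
strength is wasted: every projective K3 surface of Picard number `2` is such a partner (of its Hilbert square,
`v = δ`).

* `picardThreePartnered_of_k3SquaresPicardTwo` — **{period surjectivity, Beauville marked incidence,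
  Beauville–Fogarty, Markman 2024} + «HC⁴(S ⊗ S) for every marked projective K3 surface `S` with `ρ(S) = 2`» ⟹
  the rung** (statement VERBATIM the sketch's `PicardThreePartneredK3Sq2Hodge` with `RepresentsMinusTwo`
  unfolded). The K3 input is crux #4's territory one Picard number lower;
* `picardPartnered_of_k3Squares_realMult` (appended, p1 g36 10:06:53Z) — the same at ANY `ρ(X)`: K3 input = the
  non-CM, non-scalar (RM-core) K3 surfaces with `ρ(S) + 1 = ρ(X)` exactly; the `ρ(X) = 3` theorems are its instances;
* `picardThreePartnered_of_k3SquaresPicardTwo_realMult` (appended) — the trichotomy form: `E = ℚ` partners by the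
  fact-free scalar theorem, CM partners by `Buskin2019_hodgeConjectureFor_square_of_CM`, so the K3 input is only
  the NON-CM `ρ = 2` K3 surfaces with a non-scalar admissible endomorphism (the genuine RM core at `ρ = 2`);
* `picardThreePartnered_of_k3SquaresPicardTwo_nonScalar` — the same with the `E(S) = ℚ` partners discharged in the
  tree (`SquareGlueFree.hodgeConjectureFor_square_of_hodgeEndomorphisms_scalar`, fact-free): the K3 input shrinks to
  the `ρ = 2` K3 surfaces carrying a NON-SCALAR admissible Hodge endomorphism (the RM ∕ CM core; CM: Buskin; RM: per
  rational type the displayed `RMTypeDominated θ` of `…RMTypeDescent`).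

CONDITIONAL; no definition, no sorry, no new named fact; credits nothing; the K3 input and HC stay open. Prover seat
hodge-nonav-19716-p2 (gen 4), `--supports stmt-HodgeConjecture-19653`.

References: E. Markman, Compos. Math. 160 (2024) Thm. 1.1, 1.4; A. Beauville, J. Differential Geom. 18 (1983) §6,
§9; D. Huybrechts, *Lectures on K3 Surfaces*, Ch. 6 Thm. 3.1, Ch. 7 Thm. 4.1; Yu. Zarhin, J. reine angew. Math. 341
(1983) Thm. 1.5.1.
-/

noncomputable section

set_option linter.dupNamespace false

open Module CategoryTheory MonoidalCategory
open Literature.AlgebraicTopology.SingularHomology Literature.Geometry.Kaehler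
open Literature.AlgebraicGeometry Literature.AlgebraicGeometry.Motives Literature.AlgebraicGeometry.HodgeTheory
open Literature.AlgebraicGeometry.Hyperkaehler Literature.AlgebraicGeometry.Surfaces Literature.AlgebraicGeometry.HilbertScheme
open Summit.HodgeConjecture.HodgeConjecture.Theorems.NikulinTwinTransport
open Summit.HodgeConjecture.HodgeConjecture.Theorems.NikulinTwinTransport.SquareGlueFree
open Summit.HodgeConjecture.HodgeConjecture.Theorems.MarkmanPartnerTransport.BBFPositivity

namespace Summit.HodgeConjecture.HodgeConjecture.Theorems.MarkmanPartnerTransport.PartnerLattice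

/-- `MarkedK3Sq[X, φ, P, z]`: VERBATIM the `let MarkedK3Sq := …` binder of the route declarations of
MarkmanPartnerTransport (clauses (m1)–(m6)). Local notation only. -/
local notation3 (prettyPrint := false) "MarkedK3Sq[" X ", " φ ", " P ", " z "]" =>
  (((IsIntegralClass P ∧ ∀ Q : complexBetti X (2 * 4), IsIntegralClass Q → ∃ n : ℤ, Q = n • P) ∧
    (∀ c : complexBetti X 2, IsIntegralClass c ↔ ∃ v : K3HilbertIndex → ℤ, φ c = fun i => (v i : ℂ)) ∧
    (∀ a : complexBetti X 2, cupPowTwo a 4 = ((3 : ℂ) * (k3HilbertForm 2 (φ a) (φ a)) ^ 2) • P) ∧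
    (IsOfHodgeType 4 X 2 2 0 (LinearEquiv.symm φ z) ∧
      ∀ τ : complexBetti X 2, IsOfHodgeType 4 X 2 2 0 τ → ∃ t : ℂ, τ = t • LinearEquiv.symm φ z) ∧
    (∀ c : complexBetti X 2, IsOfHodgeType 4 X 2 1 1 c ↔
      (k3HilbertForm 2 (φ c) z = 0 ∧ k3HilbertForm 2 (φ c) (star z) = 0)) ∧
    (k3HilbertForm 2 z z = 0 ∧ 0 < (k3HilbertForm 2 (star z) z).re)))

variable {X S : SchemeOver ℂ} {φ : complexBetti X 2 ≃ₗ[ℂ] (K3HilbertIndex → ℂ)} {P : complexBetti X (2 * 4)}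
  {z : K3HilbertIndex → ℂ}

/-! ### The rung -/

/-- **The rung «PARTNERED `ρ = 3`» from HC⁴ of K3 squares at Picard number `2`** (module docstring; the sketch's
`PicardThreePartneredK3Sq2Hodge` with `RepresentsMinusTwo` unfolded): the K3-side input is displayed with the
partner's full marking ∕ projectivity clauses (those of `exists_k3Partner_of_minusTwoClass`) and `ρ(S) = 2`. [cite: Markman2024, §1.1 Thm. 1.1 and Thm. 1.4] [cite: Beauville1983, §6 (e)–(f), Prop. 6 and §9 Lemme 1]
[cite: Huybrechts2016K3, Ch. 6 Thm. 3.1, Ch. 7 Thm. 4.1] -/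
theorem picardThreePartnered_of_k3SquaresPicardTwo (hP : Huybrechts_K3_periodSurjective_projective)
    (hB : Beauville1983_hilbertSquare_markedIncidence) (hρ : Beauville1983_hilbertSquare_blowupDiagonal_surjection)
    (hMk : Markman2024_rationalHodgeIsometry_lift_algebraic_marked)
    (hK3sq : ∀ (S : SchemeOver ℂ) (η : complexBetti S (2 * 1) ≃ₗ[ℂ] (K3Index → ℂ)) (p : complexBetti S (2 * 2))
      (x : K3Index → ℂ), IsK3Surface S →
      (p ≠ 0 ∧ (IsIntegralClass p ∧ (∀ q : complexBetti S (2 * 2), IsIntegralClass q → ∃ n : ℤ, q = n • p) ∧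
        (∀ c : complexBetti S (2 * 1), IsIntegralClass c ↔ ∃ v : K3Index → ℤ, η c = fun i => (v i : ℂ)) ∧
        (∀ a b : complexBetti S (2 * 1), cupProduct (rfl : 2 * 1 + 2 * 1 = 2 * 2) a b = k3Form (η a) (η b) • p) ∧
        IsOfHodgeType 2 S (2 * 1) 2 0 (LinearEquiv.symm η x) ∧
        (∀ τ : complexBetti S (2 * 1), IsOfHodgeType 2 S (2 * 1) 2 0 τ → ∃ t : ℂ, τ = t • LinearEquiv.symm η x)) ∧
        (k3Form x x = 0 ∧ 0 < (k3Form (star x) x).re ∧ ∃ u : K3Index → ℤ,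
          k3Form (fun i => (u i : ℂ)) x = 0 ∧ 0 < ∑ i, ∑ j, u i * k3Gram i j * u j)) →
      Module.finrank ℂ (algebraicClasses S 1) = 2 → HodgeConjectureFor 4 (S ⊗ S))
    (hX : IsSmoothProjective 4 X) (hK : IsOfK3HilbertSquareType X) (hM : MarkedK3Sq[X, φ, P, z])
    (hρ3 : Module.finrank ℂ (algebraicClasses X 1) = 3) {v : K3HilbertIndex → ℚ}
    (hv : φ.symm (fun i => ((v i : ℚ) : ℂ)) ∈ algebraicClasses X 1)
    (hq : k3HilbertForm 2 (fun i => ((v i : ℚ) : ℂ)) (fun i => ((v i : ℚ) : ℂ)) = -2) :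
    HodgeConjectureFor 4 X := by
  obtain ⟨-, hint, -⟩ := id hM
  have hvrat : IsRationalClass (φ.symm (fun i => ((v i : ℚ) : ℂ))) :=
    (isRationalClass_iff_of_markedSq hX hint _).2 ⟨v, by rw [LinearEquiv.apply_symm_apply]⟩
  have hq' : k3HilbertForm 2 (φ (φ.symm (fun i => ((v i : ℚ) : ℂ)))) (φ (φ.symm (fun i => ((v i : ℚ) : ℂ)))) = -2 := by
    rw [LinearEquiv.apply_symm_apply]; exact hq
  -- X3a: a projective K3 partner with `ρ(S) = ρ(X) - 1 = 2`; then item #2 `PartnerTransport`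
  -- (the composition of `hodgeConjectureFor_of_minusTwoClass_of_partnerSquares`, inlined)
  obtain ⟨S, η, p, x, g, hS, hMS, hg, hρS⟩ := exists_k3Partner_of_minusTwoClass hP hX hM hv hvrat hq'
  have hρ2 : Module.finrank ℂ (algebraicClasses S 1) = 2 :=
    finrank_algebraicClasses_partner_eq_two_of_eq_three φ η hMS.1 hMS.2.1.2.2.2.1 g hg.2.2.2.2.2.1 hρS hρ3
  have hHC : HodgeConjectureFor 4 (S ⊗ S) := hK3sq S η p x hS hMS hρ2
  obtain ⟨-, hmk, hxx, hxpos, hu⟩ := hMS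
  obtain ⟨hg1, hg2, -, -, hg5, -, -⟩ := hg
  exact partnerTransport_explicit hB hρ hMk Theorems.Voisin2003_cupProduct_algebraicClasses_holds hX hK hM hS hmk
    hxx hxpos hu hg1 hg2 hg5 hHC


/-- **The rung «PARTNERED `ρ = 3`» modulo HC⁴ of the squares of the `ρ = 2` K3 surfaces with `E ≠ ℚ` ONLY**
(p1 g36's refinement (3), `E = ℚ` half): the `E(S) = ℚ` partners are discharged by the tree's fact-free
`SquareGlueFree.hodgeConjectureFor_square_of_hodgeEndomorphisms_scalar`, so the displayed K3 input shrinks to the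
marked projective K3 surfaces of Picard number `2` carrying a rational Hodge endomorphism of `H²` (killing `N¹`,
transcendental image) which is NOT a rational scalar on `T(S)` — the RM ∕ CM core (CM: Buskin; RM: per rational type
the displayed `RMTypeDominated θ`, `…RMTypeDescent`). [cite: Markman2024, §1.1 Thm. 1.1 and Thm. 1.4]
[cite: Zarhin1983HodgeGroupsK3, Thm. 1.5.1] [cite: GeemenSchutt2023, §2.1] -/
theorem picardThreePartnered_of_k3SquaresPicardTwo_nonScalar
    (hP : Huybrechts_K3_periodSurjective_projective)
    (hB : Beauville1983_hilbertSquare_markedIncidence) (hρ : Beauville1983_hilbertSquare_blowupDiagonal_surjection)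
    (hMk : Markman2024_rationalHodgeIsometry_lift_algebraic_marked)
    (hK3sq : ∀ (S : SchemeOver ℂ) (η : complexBetti S (2 * 1) ≃ₗ[ℂ] (K3Index → ℂ)) (p : complexBetti S (2 * 2))
      (x : K3Index → ℂ), IsK3Surface S →
      (p ≠ 0 ∧ (IsIntegralClass p ∧ (∀ q : complexBetti S (2 * 2), IsIntegralClass q → ∃ n : ℤ, q = n • p) ∧
        (∀ c : complexBetti S (2 * 1), IsIntegralClass c ↔ ∃ v : K3Index → ℤ, η c = fun i => (v i : ℂ)) ∧
        (∀ a b : complexBetti S (2 * 1), cupProduct (rfl : 2 * 1 + 2 * 1 = 2 * 2) a b = k3Form (η a) (η b) • p) ∧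
        IsOfHodgeType 2 S (2 * 1) 2 0 (LinearEquiv.symm η x) ∧
        (∀ τ : complexBetti S (2 * 1), IsOfHodgeType 2 S (2 * 1) 2 0 τ → ∃ t : ℂ, τ = t • LinearEquiv.symm η x)) ∧
        (k3Form x x = 0 ∧ 0 < (k3Form (star x) x).re ∧ ∃ u : K3Index → ℤ,
          k3Form (fun i => (u i : ℂ)) x = 0 ∧ 0 < ∑ i, ∑ j, u i * k3Gram i j * u j)) →
      Module.finrank ℂ (algebraicClasses S 1) = 2 →
      (∃ f : complexBetti S (2 * 1) →ₗ[ℂ] complexBetti S (2 * 1),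
        (∀ y, IsRationalClass y → IsRationalClass (f y)) ∧
        (∀ (i j : ℕ) y, IsOfHodgeType 2 S (2 * 1) i j y → IsOfHodgeType 2 S (2 * 1) i j (f y)) ∧
        (∀ d ∈ algebraicClasses S 1, f d = 0) ∧
        (∀ y : complexBetti S (2 * 1), ∀ d ∈ algebraicClasses S 1,
          cupProduct (rfl : 2 * 1 + 2 * 1 = 2 * 2) (f y) d = 0) ∧
        ∀ a : ℚ, ∃ y : complexBetti S (2 * 1),
          (∀ d ∈ algebraicClasses S 1, cupProduct (rfl : 2 * 1 + 2 * 1 = 2 * 2) y d = 0) ∧ f y ≠ (a : ℂ) • y) →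
      HodgeConjectureFor 4 (S ⊗ S))
    (hX : IsSmoothProjective 4 X) (hK : IsOfK3HilbertSquareType X) (hM : MarkedK3Sq[X, φ, P, z])
    (hρ3 : Module.finrank ℂ (algebraicClasses X 1) = 3) {v : K3HilbertIndex → ℚ}
    (hv : φ.symm (fun i => ((v i : ℚ) : ℂ)) ∈ algebraicClasses X 1)
    (hq : k3HilbertForm 2 (fun i => ((v i : ℚ) : ℂ)) (fun i => ((v i : ℚ) : ℂ)) = -2) :
    HodgeConjectureFor 4 X := by
  classical
  refine picardThreePartnered_of_k3SquaresPicardTwo hP hB hρ hMk (fun S η p x hS hMS hρ2 => ?_) hX hK hM hρ3 hv hq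
  by_cases hU₀ : ∀ (f : complexBetti S (2 * 1) →ₗ[ℂ] complexBetti S (2 * 1)),
      (∀ y, IsRationalClass y → IsRationalClass (f y)) →
      (∀ (i j : ℕ) y, IsOfHodgeType 2 S (2 * 1) i j y → IsOfHodgeType 2 S (2 * 1) i j (f y)) →
      (∀ d ∈ algebraicClasses S 1, f d = 0) →
      (∀ y : complexBetti S (2 * 1), ∀ d ∈ algebraicClasses S 1,
        cupProduct (rfl : 2 * 1 + 2 * 1 = 2 * 2) (f y) d = 0) →
      ∃ a : ℚ, ∀ y : complexBetti S (2 * 1),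
        (∀ d ∈ algebraicClasses S 1, cupProduct (rfl : 2 * 1 + 2 * 1 = 2 * 2) y d = 0) →
        f y = (a : ℂ) • y
  · -- `E(S) = ℚ`: fact-free tree theorem
    exact hodgeConjectureFor_square_of_hodgeEndomorphisms_scalar hS.isSmoothProjective hU₀
  · -- otherwise a non-scalar admissible endomorphism exists: the displayed input
    refine hK3sq S η p x hS hMS hρ2 ?_
    by_contra hcon
    apply hU₀
    intro f hf₁ hf₂ hf₃ hf₄
    by_contra hcon'
    apply hcon
    refine ⟨f, hf₁, hf₂, hf₃, hf₄, fun a => ?_⟩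
    by_contra hcon''
    apply hcon'
    refine ⟨a, fun y hy => ?_⟩
    by_contra hne
    exact hcon'' ⟨y, hy, hne⟩


/-- **The rung «PARTNERED `ρ = 3`» modulo HC⁴ of the squares of the GENUINELY-RM `ρ = 2` K3 surfaces only**
(p1 g36's refinement (3), trichotomy form): the `E(S) = ℚ` partners are discharged by the fact-free
`SquareGlueFree.hodgeConjectureFor_square_of_hodgeEndomorphisms_scalar`, the CM partners by the displayed printed
fact `Buskin2019_hodgeConjectureFor_square_of_CM` (Buskin's corollary ∕ Huybrechts 2019 Cor. 0.4 (ii)), so the K3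
input is only asked for marked projective K3 surfaces `S` with `ρ(S) = 2`, NOT of CM type, carrying an admissible
rational Hodge endomorphism of `H²` (killing `N¹`, transcendental image) that is not a rational scalar on `T(S)` —
i.e. `E(S)` totally real `≠ ℚ`: the real-multiplication core at Picard number `2`, which `RMTypeDescent` reduces per
rational type to the displayed `RMTypeDominated θ`. Modulo {period surjectivity, Beauville marked incidence,
Beauville–Fogarty, Markman 2024, Buskin CM}; credits nothing.
[cite: Buskin2019, Corollary (Introduction, after Thm. 1.1)] [cite: Huybrechts2019, Cor. 0.4 (ii)]
[cite: Markman2024, §1.1 Thm. 1.1 and Thm. 1.4] [cite: Zarhin1983HodgeGroupsK3, Thm. 1.5.1] -/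
theorem picardThreePartnered_of_k3SquaresPicardTwo_realMult
    (hP : Huybrechts_K3_periodSurjective_projective)
    (hB : Beauville1983_hilbertSquare_markedIncidence) (hρ : Beauville1983_hilbertSquare_blowupDiagonal_surjection)
    (hMk : Markman2024_rationalHodgeIsometry_lift_algebraic_marked)
    (hCM : Buskin2019_hodgeConjectureFor_square_of_CM)
    (hK3sq : ∀ (S : SchemeOver ℂ) (η : complexBetti S (2 * 1) ≃ₗ[ℂ] (K3Index → ℂ)) (p : complexBetti S (2 * 2))
      (x : K3Index → ℂ), IsK3Surface S → ¬ HasComplexMultiplication S →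
      (p ≠ 0 ∧ (IsIntegralClass p ∧ (∀ q : complexBetti S (2 * 2), IsIntegralClass q → ∃ n : ℤ, q = n • p) ∧
        (∀ c : complexBetti S (2 * 1), IsIntegralClass c ↔ ∃ v : K3Index → ℤ, η c = fun i => (v i : ℂ)) ∧
        (∀ a b : complexBetti S (2 * 1), cupProduct (rfl : 2 * 1 + 2 * 1 = 2 * 2) a b = k3Form (η a) (η b) • p) ∧
        IsOfHodgeType 2 S (2 * 1) 2 0 (LinearEquiv.symm η x) ∧
        (∀ τ : complexBetti S (2 * 1), IsOfHodgeType 2 S (2 * 1) 2 0 τ → ∃ t : ℂ, τ = t • LinearEquiv.symm η x)) ∧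
        (k3Form x x = 0 ∧ 0 < (k3Form (star x) x).re ∧ ∃ u : K3Index → ℤ,
          k3Form (fun i => (u i : ℂ)) x = 0 ∧ 0 < ∑ i, ∑ j, u i * k3Gram i j * u j)) →
      Module.finrank ℂ (algebraicClasses S 1) = 2 →
      (∃ f : complexBetti S (2 * 1) →ₗ[ℂ] complexBetti S (2 * 1),
        (∀ y, IsRationalClass y → IsRationalClass (f y)) ∧
        (∀ (i j : ℕ) y, IsOfHodgeType 2 S (2 * 1) i j y → IsOfHodgeType 2 S (2 * 1) i j (f y)) ∧
        (∀ d ∈ algebraicClasses S 1, f d = 0) ∧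
        (∀ y : complexBetti S (2 * 1), ∀ d ∈ algebraicClasses S 1,
          cupProduct (rfl : 2 * 1 + 2 * 1 = 2 * 2) (f y) d = 0) ∧
        ∀ a : ℚ, ∃ y : complexBetti S (2 * 1),
          (∀ d ∈ algebraicClasses S 1, cupProduct (rfl : 2 * 1 + 2 * 1 = 2 * 2) y d = 0) ∧ f y ≠ (a : ℂ) • y) →
      HodgeConjectureFor 4 (S ⊗ S))
    (hX : IsSmoothProjective 4 X) (hK : IsOfK3HilbertSquareType X) (hM : MarkedK3Sq[X, φ, P, z])
    (hρ3 : Module.finrank ℂ (algebraicClasses X 1) = 3) {v : K3HilbertIndex → ℚ}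
    (hv : φ.symm (fun i => ((v i : ℚ) : ℂ)) ∈ algebraicClasses X 1)
    (hq : k3HilbertForm 2 (fun i => ((v i : ℚ) : ℂ)) (fun i => ((v i : ℚ) : ℂ)) = -2) :
    HodgeConjectureFor 4 X := by
  classical
  refine picardThreePartnered_of_k3SquaresPicardTwo_nonScalar hP hB hρ hMk
    (fun S η p x hS hMS hρ2 hf => ?_) hX hK hM hρ3 hv hq
  by_cases hcm : HasComplexMultiplication S
  · exact hCM S hS hcm
  · exact hK3sq S η p x hS hcm hMS hρ2 hf


/-! ### «PARTNERED, ANY `ρ(X)`» -/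

/-- **«PARTNERED», at ANY Picard rank: HC⁴(X) for every marked smooth projective `K3^{[2]}`-type `X` carrying a
rational algebraic class of Beauville–Bogomolov square `−2`, modulo {period surjectivity, Beauville marked incidence,
Beauville–Fogarty, Markman 2024, Buskin-CM} and the RM core of K3 squares at Picard number EXACTLY `ρ(X) − 1`.**
The K3-square input is only asked for marked projective K3 surfaces `S`, NOT of CM type, with
`ρ(S) + 1 = ρ(X)` (the partner's Picard number, `finrank_algebraicClasses_succ_eq_of_partner`, 20241-p1 g12) and
carrying an admissible rational Hodge endomorphism which is not a rational scalar on `T(S)` (`E(S)` totally real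
`≠ ℚ`); the `E(S) = ℚ` partners are discharged by the fact-free
`SquareGlueFree.hodgeConjectureFor_square_of_hodgeEndomorphisms_scalar`, the CM ones by
`Buskin2019_hodgeConjectureFor_square_of_CM`. `picardThreePartnered_of_k3SquaresPicardTwo_realMult` is the instance
`ρ(X) = 3`. The complement — no rational algebraic `(−2)`-class — is the K3-ORPHAN population (no projective K3
partner at all). CONDITIONAL; credits nothing. [cite: Markman2024, §1.1 Thm. 1.1 and Thm. 1.4]
[cite: Buskin2019, Corollary (Introduction, after Thm. 1.1)] [cite: Huybrechts2016K3, Ch. 6 Thm. 3.1, Ch. 7 Thm. 4.1]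
[cite: Zarhin1983HodgeGroupsK3, Thm. 1.5.1] -/
theorem picardPartnered_of_k3Squares_realMult
    (hP : Huybrechts_K3_periodSurjective_projective)
    (hB : Beauville1983_hilbertSquare_markedIncidence) (hρ : Beauville1983_hilbertSquare_blowupDiagonal_surjection)
    (hMk : Markman2024_rationalHodgeIsometry_lift_algebraic_marked)
    (hCM : Buskin2019_hodgeConjectureFor_square_of_CM)
    (hX : IsSmoothProjective 4 X) (hK : IsOfK3HilbertSquareType X) (hM : MarkedK3Sq[X, φ, P, z])
    (hK3sq : ∀ (S : SchemeOver ℂ) (η : complexBetti S (2 * 1) ≃ₗ[ℂ] (K3Index → ℂ)) (p : complexBetti S (2 * 2))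
      (x : K3Index → ℂ), IsK3Surface S → ¬ HasComplexMultiplication S →
      (p ≠ 0 ∧ (IsIntegralClass p ∧ (∀ q : complexBetti S (2 * 2), IsIntegralClass q → ∃ n : ℤ, q = n • p) ∧
        (∀ c : complexBetti S (2 * 1), IsIntegralClass c ↔ ∃ v : K3Index → ℤ, η c = fun i => (v i : ℂ)) ∧
        (∀ a b : complexBetti S (2 * 1), cupProduct (rfl : 2 * 1 + 2 * 1 = 2 * 2) a b = k3Form (η a) (η b) • p) ∧
        IsOfHodgeType 2 S (2 * 1) 2 0 (LinearEquiv.symm η x) ∧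
        (∀ τ : complexBetti S (2 * 1), IsOfHodgeType 2 S (2 * 1) 2 0 τ → ∃ t : ℂ, τ = t • LinearEquiv.symm η x)) ∧
        (k3Form x x = 0 ∧ 0 < (k3Form (star x) x).re ∧ ∃ u : K3Index → ℤ,
          k3Form (fun i => (u i : ℂ)) x = 0 ∧ 0 < ∑ i, ∑ j, u i * k3Gram i j * u j)) →
      Module.finrank ℂ (algebraicClasses S 1) + 1 = Module.finrank ℂ (algebraicClasses X 1) →
      (∃ f : complexBetti S (2 * 1) →ₗ[ℂ] complexBetti S (2 * 1),
        (∀ y, IsRationalClass y → IsRationalClass (f y)) ∧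
        (∀ (i j : ℕ) y, IsOfHodgeType 2 S (2 * 1) i j y → IsOfHodgeType 2 S (2 * 1) i j (f y)) ∧
        (∀ d ∈ algebraicClasses S 1, f d = 0) ∧
        (∀ y : complexBetti S (2 * 1), ∀ d ∈ algebraicClasses S 1,
          cupProduct (rfl : 2 * 1 + 2 * 1 = 2 * 2) (f y) d = 0) ∧
        ∀ a : ℚ, ∃ y : complexBetti S (2 * 1),
          (∀ d ∈ algebraicClasses S 1, cupProduct (rfl : 2 * 1 + 2 * 1 = 2 * 2) y d = 0) ∧ f y ≠ (a : ℂ) • y) →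
      HodgeConjectureFor 4 (S ⊗ S))
    {v : K3HilbertIndex → ℚ} (hv : φ.symm (fun i => ((v i : ℚ) : ℂ)) ∈ algebraicClasses X 1)
    (hq : k3HilbertForm 2 (fun i => ((v i : ℚ) : ℂ)) (fun i => ((v i : ℚ) : ℂ)) = -2) :
    HodgeConjectureFor 4 X := by
  classical
  obtain ⟨-, hint, -⟩ := id hM
  have hvrat : IsRationalClass (φ.symm (fun i => ((v i : ℚ) : ℂ))) :=
    (isRationalClass_iff_of_markedSq hX hint _).2 ⟨v, by rw [LinearEquiv.apply_symm_apply]⟩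
  have hq' : k3HilbertForm 2 (φ (φ.symm (fun i => ((v i : ℚ) : ℂ)))) (φ (φ.symm (fun i => ((v i : ℚ) : ℂ)))) = -2 := by
    rw [LinearEquiv.apply_symm_apply]; exact hq
  -- the partner and its Picard number `ρ(S) = ρ(X) - 1`
  obtain ⟨S, η, p, x, g, hS, hMS, hg, hρS⟩ := exists_k3Partner_of_minusTwoClass hP hX hM hv hvrat hq'
  have hρeq : Module.finrank ℂ (algebraicClasses S 1) + 1 = Module.finrank ℂ (algebraicClasses X 1) :=
    finrank_algebraicClasses_succ_eq_of_partner φ η hMS.1 hMS.2.1.2.2.2.1 g hg.2.2.2.2.2.1 hρS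
  -- HC⁴(S ⊗ S) by trichotomy: `E = ℚ` (tree), CM (Buskin), RM core (input)
  have hHC : HodgeConjectureFor 4 (S ⊗ S) := by
    by_cases hU₀ : ∀ (f : complexBetti S (2 * 1) →ₗ[ℂ] complexBetti S (2 * 1)),
        (∀ y, IsRationalClass y → IsRationalClass (f y)) →
        (∀ (i j : ℕ) y, IsOfHodgeType 2 S (2 * 1) i j y → IsOfHodgeType 2 S (2 * 1) i j (f y)) →
        (∀ d ∈ algebraicClasses S 1, f d = 0) →
        (∀ y : complexBetti S (2 * 1), ∀ d ∈ algebraicClasses S 1,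
          cupProduct (rfl : 2 * 1 + 2 * 1 = 2 * 2) (f y) d = 0) →
        ∃ a : ℚ, ∀ y : complexBetti S (2 * 1),
          (∀ d ∈ algebraicClasses S 1, cupProduct (rfl : 2 * 1 + 2 * 1 = 2 * 2) y d = 0) →
          f y = (a : ℂ) • y
    · exact hodgeConjectureFor_square_of_hodgeEndomorphisms_scalar hS.isSmoothProjective hU₀
    · by_cases hcm : HasComplexMultiplication S
      · exact hCM S hS hcm
      · refine hK3sq S η p x hS hcm hMS hρeq ?_
        by_contra hcon
        apply hU₀
        intro f hf₁ hf₂ hf₃ hf₄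
        by_contra hcon'
        apply hcon
        refine ⟨f, hf₁, hf₂, hf₃, hf₄, fun a => ?_⟩
        by_contra hcon''
        apply hcon'
        refine ⟨a, fun y hy => ?_⟩
        by_contra hne
        exact hcon'' ⟨y, hy, hne⟩
  obtain ⟨-, hmk, hxx, hxpos, hu⟩ := hMS
  obtain ⟨hg1, hg2, -, -, hg5, -, -⟩ := hg
  exact partnerTransport_explicit hB hρ hMk Theorems.Voisin2003_cupProduct_algebraicClasses_holds hX hK hM hS hmk
    hxx hxpos hu hg1 hg2 hg5 hHC

end Summit.HodgeConjecture.HodgeConjecture.Theorems.MarkmanPartnerTransport.PartnerLattice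

end
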